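import Mathlib
import HarnessLib
import Literature.MathematicalPhysics.QuantumLattice.GaugeGroups
import Literature.MathematicalPhysics.QuantumFieldTheory.ConstructiveQFTWave0
import Literature.MathematicalPhysics.QuantumFieldTheory.UnitaryCayleyChart
import Summits.Ventures.LatticeQCDFlow.Scaling.EntropicTransportInstances
import Summits.Ventures.LatticeQCDFlow.Scaling.HeatingContractionBetween

/-!
# LatticeQCDFlow / Scaling — barrier supplement v2.8: THE TRANSPORT SQUARE (entropic power laws in both directions; heating flows contract exponentially)

HONEST FRAMING: exact (Metropolis-corrected) sampling algorithms for lattice gauge theory;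
figures of merit are autocorrelation/cost numbers at stated couplings and volumes; no
continuum-physics claim.

THEORY-2.md §5.11 supplement 6 (theory seat GEN-13).  Two PROVED supplements to `TransportExpansionLaw` /
`TransportContractionLaw` (`Scaling/BarriersTransport.lean`, v2.6) and `TransportWindowLaw`
(`Scaling/BarriersTransportBetween.lean`, v2.7), in the barrier-docstring format (`technique_class` · `blocks` ·
`because` · `evasions_known` · `scope_caveats` · `nearest_prior_art` · `status`): each a `def … : Prop`
immediately DISCHARGED by the instances of `Scaling/EntropicTransportInstances.lean` and
`Scaling/HeatingContractionBetween.lean`.  Together with the window law they are the four corners of the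
TRANSPORT SQUARE for an exact deterministic map between two couplings `β_hot < β_cold` (both directions, both
one-sided moduli):

| exact map | Lipschitz side | co-Lipschitz side |
|---|---|---|
| cooling `μ_{β_hot} → μ_{β_cold}` | `e^{c(β_cold-β_hot)}` (`TransportWindowLaw`) | `(β_cold/β_hot)^{(d-1)/(2d)}` (`EntropicTransportLaw`, here) |
| heating `μ_{β_cold} → μ_{β_hot}` | `(β_cold/β_hot)^{(d-1)/(2d)}` (`EntropicTransportLaw`, here) | `e^{c(β_cold-β_hot)}` (`HeatingContractionLaw`, here) |

The EXPONENTIAL corners sit on the side that must populate the rare high-action configurations of the hotter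
measure from the colder one; the ENTROPIC corners are power laws whose exponent `(d-1)/(2d)·(1 - O(1/L))` is the
mean log-Jacobian (`n_tr/2` transverse directions out of `κ·d·L^d`) and cannot be beaten by any architecture.
`transportContractionLaw_of_entropic` records that the entropic law contains the v2.6 contraction law with the
volumetric exponent.  The barrier NAMES of record (VolumeScalingOfTraining, TopologicalModeCollapse,
ExactnessVsExpressivity, FermionDeterminantCost) are unchanged; the literature named under `nearest_prior_art` is
CONTEXT found by search (THEORY-2.md §8 (41)), nothing is imported from it.
-/

noncomputable section

namespace Summit.Ventures.LatticeQCDFlow.Barriers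

open scoped Matrix.Norms.Frobenius
open Literature.MathematicalPhysics.QuantumFieldTheory.UnitaryCayley (𝔾)
open Literature.MathematicalPhysics.QuantumLattice (u1Rep unitaryFundamentalRep fundamentalRep)

/-- **Supplement (EntropicTransportLaw) to ExactnessVsExpressivity / TransportContractionLaw — between two
couplings an exact flow pays a VOLUME-UNIFORM POWER of the coupling ratio on its entropic side, in EITHER
direction.**  For `G = U(1)` (chordal metric, `κ = 1`), `G = U(N)`, `N ≥ 1` (`κ = N²`), and `G = SU(N)`,
`N ≥ 2` (`κ = N² - 1`; Hilbert–Schmidt metric), Wilson action in the defining representation, every `d ≥ 1`: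
there is `C` such that for every `L ≥ 2`, with `c_lo(L) = (d-1)L^d(1/2-1/L) - 1/2`, `c_up(L) = ((d-1)L^d+1)/2`:
(HEATING) for every `1 ≤ β ≤ β₀` and every `K`-Lipschitz (sup metric) map `T : G^E → G^E` with
`T_*μ_{Λ_L,β₀} = μ_{Λ_L,β}` EXACTLY, `κ(c_lo(L)·log β₀ - c_up(L)·log β) - C·L^d ≤ κ·d·L^d·log K`, i.e.
`log Lip(T) ≥ ((d-1)/(2d))(1 - O(1/L))·log(β₀/β) - O(1/L)·log β₀ - C/κ`;
(COOLING) for every `1 ≤ β₀ ≤ β` and every `K'`-co-Lipschitz exact `T` (`dist x y ≤ K'·dist (Tx) (Ty)`),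
`κ(c_lo(L)·log β - c_up(L)·log β₀) - C·L^d ≤ κ·d·L^d·log K'`;
(FROM THE PRIOR, `SU(N)`) for every `β ≥ 1` and every `K'`-co-Lipschitz exact transport of `Haar^{⊗E}` onto
`μ_{Λ_L,β}`, `κ·c_lo(L)·log β - C·L^d ≤ κ·d·L^d·log K'` (`d = 4`, `N = 3`: `log coLip ≥ (3/8)(1 - O(1/L))·log β - C/8`).
technique_class: deterministic exact flows realised as ONE map (or a stack read as one map) between two Wilson
  measures of the same action — trivializing / `β`-matched continuous flows read between two flow times,
  coupling-transfer and retrained-conditional flows, the INVERSE pass of a trained cooling flow used as a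
  proposal at the hotter coupling — judged by a one-sided modulus (Lipschitz constant, or co-Lipschitz constant
  = Lipschitz constant of the inverse relation) that is uniform in the coupling ratio.
blocks: "an exact flow trained at `β₀` transfers to `β ≠ β₀` at no capacity cost", in EITHER direction, and
  every `β`-uniform contraction / expansion budget for exact flows; quantitatively the log-capacity
  `κ·#E·log(modulus)` must grow like `(n_tr/2)·log(β_cold/β_hot)`, `n_tr = κ(d-1)L^d` — EXTENSIVE as a total,
  `O(1)` per link.
because: PROVED `Theory2.Lattice.U1./UN./SUN.heatingExpansionBetween`, `….coolingContractionBetween`,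
  `Theory2.Lattice.SUN.exactTransportContractionSharp` (`Scaling/EntropicTransportInstances.lean`), from the two
  ENTROPIC INEQUALITIES of `Scaling/EntropicTransportSteps.lean` — `D_{β₀} - D_β ≤ #E(log(A/a) + κ log Lip T)`,
  `D_β - D_{β₀} ≤ #E(log(A/a) + κ log coLip T)` for exact transports between ANY two Wilson measures
  (`D_β = D(μ_{Λ,β} ‖ Haar^{⊗E})`; STEP 1′ / STEP 2′ integrated against `μ_{β₀}` and read through the Gibbs
  identity `D_β = -β⟨S⟩_β - log Z_β`) — and the tree's two-sided sharp entropy growth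
  `κ·c_lo(L)·log β - C L^d ≤ D_β ≤ κ·c_up(L)·log β + C L^d` (`Scaling/LatticeEntropyGrowthSharp.lean`,
  `LatticeEntropyU1/UN/SUNLaw.lean`); `#E = d·L^d`, the `L^d` cancel.
evasions_known: (i) ε-ACCURACY — the laws are exactness statements (a TV-accurate map need not satisfy the
  pointwise density step); the ε-robust contraction law keeps the weaker exponent `1/(16d)`
  (`AccurateTransportContractionLaw`, `Scaling/BarriersAccurateTransport.lean`); (ii) STOCHASTIC layers are not
  maps and pay `CapacityRatioLaw` / `AnnealingStepLaw` instead (`Scaling/BarriersEntropyBetween.lean`,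
  `Scaling/Barriers.lean`); (iii) a reference that is not a Wilson measure of the same action (tailed /
  Lie-algebra priors) is outside the statement.
scope_caveats: EXACT transport only; NECESSARY conditions on one map, not sufficient; the laws are EMPTY for
  windows `log(β_cold/β_hot) ≲ (2/L)·log β_cold` (the `O(1/L)` slack of the entropy-growth law: boundary of the
  tree gauge `(d-1)/L` and the zero mode `1/(2L^d)`); between nearby couplings the entropic side is cheap
  (`SU(3)`, `d = 4`, `6.0 → 6.4`: ≈ 2.5 % per link) — it binds from the prior and across wide windows; constants
  `C = 2C_EG + d·log(A/a)` not optimised; `β, β₀ ≥ 1` (the entropy-growth law's range).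
nearest_prior_art: the smooth Euclidean identity `E log|det ∇φ| = h(φ_*η) - h(η)` (Cover–Thomas, *Elements of
  Information Theory*, Thm 8.6.4) and the transfer of entropy-type / functional inequalities along LIPSCHITZ
  transport maps (Mikulincer–Shenfeld, GAFA Seminar Notes, LNM 2327 (2023) 237–246: `|det ∇φ| ≤ 1 ⇒`
  majorisation `η ≺ φ_*η ⇒` Rényi entropies monotone; Caffarelli / Kim–Milman contraction) — here in
  metric-measure form on a compact group (two-sided Haar ball volumes replace the Jacobian; no smoothness, no
  injectivity), in BOTH one-sided directions, and used CONVERSELY as a necessity law between two Gibbs measures.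
  Searched (THEORY-2.md §8 (41), corpus fts+vec and galaxy): no printed statement of this kind for lattice gauge
  flows; empirical volume scalings of flow samplers (Abbott et al. arXiv:2211.07541 §IV–V; Bulgarelli–Cellini–Nada
  arXiv:2412.00200) are a different currency (ESS / training cost).
status: PROVED (`entropicTransportLaw`). -/
def EntropicTransportLaw : Prop :=
  (∀ d : ℕ, 1 ≤ d → Theory2.Lattice.HeatingExpansionBetween d 1 Circle u1Rep 1 ∧
    Theory2.Lattice.CoolingContractionBetween d 1 Circle u1Rep 1) ∧
  (∀ d N : ℕ, 1 ≤ d → 1 ≤ N →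
    @Theory2.Lattice.HeatingExpansionBetween d N (𝔾 N) _ Subtype.metricSpace
      Theory2.Lattice.UN.isTopologicalGroup_hs Theory2.Lattice.UN.compactSpace_hs _
      Theory2.Lattice.UN.borelSpace_hs (unitaryFundamentalRep (Fin N) ℂ) ((N : ℝ) ^ 2) ∧
    @Theory2.Lattice.CoolingContractionBetween d N (𝔾 N) _ Subtype.metricSpace
      Theory2.Lattice.UN.isTopologicalGroup_hs Theory2.Lattice.UN.compactSpace_hs _
      Theory2.Lattice.UN.borelSpace_hs (unitaryFundamentalRep (Fin N) ℂ) ((N : ℝ) ^ 2)) ∧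
  (∀ d N : ℕ, 1 ≤ d → 2 ≤ N →
    @Theory2.Lattice.HeatingExpansionBetween d N (Matrix.specialUnitaryGroup (Fin N) ℂ) _
      Subtype.metricSpace Theory2.Lattice.SUN.isTopologicalGroup_hs Theory2.Lattice.SUN.compactSpace_hs _
      Theory2.Lattice.SUN.borelSpace_hs (fundamentalRep (Fin N)) ((N : ℝ) ^ 2 - 1) ∧
    @Theory2.Lattice.CoolingContractionBetween d N (Matrix.specialUnitaryGroup (Fin N) ℂ) _
      Subtype.metricSpace Theory2.Lattice.SUN.isTopologicalGroup_hs Theory2.Lattice.SUN.compactSpace_hs _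
      Theory2.Lattice.SUN.borelSpace_hs (fundamentalRep (Fin N)) ((N : ℝ) ^ 2 - 1) ∧
    @Theory2.Lattice.ExactTransportContractionSharp d N (Matrix.specialUnitaryGroup (Fin N) ℂ) _
      Subtype.metricSpace Theory2.Lattice.SUN.isTopologicalGroup_hs Theory2.Lattice.SUN.compactSpace_hs _
      Theory2.Lattice.SUN.borelSpace_hs (fundamentalRep (Fin N)) ((N : ℝ) ^ 2 - 1))

/-- Discharge of `EntropicTransportLaw` by the instances of `Scaling/EntropicTransportInstances.lean`. -/
theorem entropicTransportLaw : EntropicTransportLaw :=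
  ⟨fun d hd => ⟨Theory2.Lattice.U1.heatingExpansionBetween d hd, Theory2.Lattice.U1.coolingContractionBetween d hd⟩,
    fun d N hd hN => ⟨Theory2.Lattice.UN.heatingExpansionBetween d N hd hN,
      Theory2.Lattice.UN.coolingContractionBetween d N hd hN⟩,
    fun d N hd hN => ⟨Theory2.Lattice.SUN.heatingExpansionBetween d N hd hN,
      Theory2.Lattice.SUN.coolingContractionBetween d N hd hN,
      Theory2.Lattice.SUN.exactTransportContractionSharp d N hd hN⟩⟩

/-- **The entropic law contains the v2.6 contraction law for `SU(N)` with the VOLUMETRIC exponent**: for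
`d ≥ 2`, `N ≥ 2`, `Theory2.Lattice.ExactTransportContraction d N SU(N) ρ_fund` holds with `c = ((d-1)/4 - 1/32)/d`
(`23/128` at `d = 4`; the tree's `SUN.exactTransportContraction` has `1/(16d) = 1/64`), via
`Theory2.Lattice.exactTransportContraction_of_sharp`. -/
theorem transportContractionLaw_of_entropic (h : EntropicTransportLaw) (d N : ℕ) (hd : 2 ≤ d) (hN : 2 ≤ N) :
    @Theory2.Lattice.ExactTransportContraction d N (Matrix.specialUnitaryGroup (Fin N) ℂ) _
      Subtype.metricSpace Theory2.Lattice.SUN.isTopologicalGroup_hs Theory2.Lattice.SUN.compactSpace_hs _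
      Theory2.Lattice.SUN.borelSpace_hs (fundamentalRep (Fin N)) := by
  have hκ : (0 : ℝ) < (N : ℝ) ^ 2 - 1 := by
    have : (2 : ℝ) ≤ N := by exact_mod_cast hN
    nlinarith
  exact @Theory2.Lattice.exactTransportContraction_of_sharp N (Matrix.specialUnitaryGroup (Fin N) ℂ) _
    Subtype.metricSpace Theory2.Lattice.SUN.isTopologicalGroup_hs Theory2.Lattice.SUN.compactSpace_hs _
    Theory2.Lattice.SUN.borelSpace_hs (fundamentalRep (Fin N)) d hd ((N : ℝ) ^ 2 - 1) hκ
    ((h.2.2 d N (by omega) hN).2.2)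

/-- **Supplement (HeatingContractionLaw) to TransportWindowLaw / ExactnessVsExpressivity — the fourth corner:
an exact flow that HEATS the ensemble must CONTRACT EXPONENTIALLY in the window, uniformly in the volume,
invertible or not.**  For `G = U(1)`, `U(N)` (`N ≥ 1`), `SU(N)` (`N ≥ 2`), defining representation, `d ≥ 2`:
there are `c > 0`, `C` such that for every `L ≥ 2`, every `0 ≤ β ≤ β₀` and every map `T : G^E → G^E` that is
`K'`-co-Lipschitz for the sup metric (`dist x y ≤ K'·dist (Tx) (Ty)`) and EXACT, `T_*μ_{Λ_L,β₀} = μ_{Λ_L,β}`: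
`K' ≥ e^{c(β₀-β) - C}` — the same `c = 3s₀/(4κd)`, `C` as the window law.  In particular (`β = 0`) every exact
TRIVIALIZING map `T_*μ_{Λ,β₀} = Haar^{⊗E}` has `coLip(T) ≥ e^{cβ₀ - C}` (`Theory2.Lattice.SUN.trivializingMapContraction`),
and a stack of `n` layers, each `Λ'`-co-Lipschitz, realising a heating flow exactly has `n·log Λ' ≥ c(β₀-β) - C`
(`Theory2.Lattice.SUN.layerContractionDepthHeating`).
technique_class: as `TransportWindowLaw`, read in the HEATING direction — inverse passes of trivializing /
  coupling-transfer flows, flows towards smaller coupling, exact trivializations (Lüscher) realised by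
  non-invertible maps; judged by the co-Lipschitz constant (for an invertible layer stack: the Lipschitz
  constant of the inverse network, the "exploding inverse" modulus).
blocks: "running the flow backwards (towards the strong-coupling / Haar end) is free of the exponential
  obstruction" — it is not: the exponential moves to the co-Lipschitz side; for invertible `T` this is the
  window law for `T⁻¹`, and the entry removes invertibility.
because: PROVED `Theory2.Lattice.U1./UN./SUN.heatingContractionBetween` (`heatingContractionBetween_of_ballVolumes`,
  `Scaling/HeatingContractionBetween.lean`): STEP 2′ `log Z_{β₀} - log Z_β + β₀ S(x) - β S(Tx) ≤ #E(log(A/a) +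
  κ log K')` at an action MAXIMISER `x_M` (`S(T x_M) ≤ S(x_M) = S_max ≥ s₀L^d`, staircase witness), plus the
  sublevel `Z`-ratio bound `log Z_{β₀} - log Z_β ≥ -(β₀-β)s₀L^d/4 + #E(log a + κ log r₀)`; the `L^d` cancel:
  `κd·log K' ≥ (3/4)s₀(β₀-β) - d·C₁`.
evasions_known: (i) ε-ACCURACY (exactness artefact, as all exponential corners: driven by the configurations
  near the action maximum, `μ_{β₀}`-mass `e^{-Θ(β₀L^d)}`); (ii) tailed references; (iii) stochastic layers —
  exactly as for `TransportWindowLaw`.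
scope_caveats: EXACT transport only; `0 ≤ β ≤ β₀`; `d ≥ 2` (the staircase witness); sup metric; `C` not sharp.
nearest_prior_art: as `TransportWindowLaw` (Bauerschmidt–Bodineau–Dagallier arXiv:2307.07619; Shenfeld
  arXiv:2205.01642; Behrmann et al. arXiv:2006.09347 on exploding inverses; Cornish et al. arXiv:1909.13833
  Thm 2.1); Lüscher, Commun. Math. Phys. 293 (2010) 899 = arXiv:0907.5491 for trivializing maps.  Searched
  (THEORY-2.md §8 (40)–(41)): no printed law of this kind.
status: PROVED (`heatingContractionLaw`). -/
def HeatingContractionLaw : Prop :=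
  (∀ d : ℕ, 2 ≤ d → Theory2.Lattice.HeatingContractionBetween d 1 Circle u1Rep) ∧
  (∀ d N : ℕ, 2 ≤ d → 1 ≤ N →
    @Theory2.Lattice.HeatingContractionBetween d N (𝔾 N) _ Subtype.metricSpace
      Theory2.Lattice.UN.isTopologicalGroup_hs Theory2.Lattice.UN.compactSpace_hs _
      Theory2.Lattice.UN.borelSpace_hs (unitaryFundamentalRep (Fin N) ℂ)) ∧
  (∀ d N : ℕ, 2 ≤ d → 2 ≤ N →
    @Theory2.Lattice.HeatingContractionBetween d N (Matrix.specialUnitaryGroup (Fin N) ℂ) _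
      Subtype.metricSpace Theory2.Lattice.SUN.isTopologicalGroup_hs Theory2.Lattice.SUN.compactSpace_hs _
      Theory2.Lattice.SUN.borelSpace_hs (fundamentalRep (Fin N)))

/-- Discharge of `HeatingContractionLaw` by the three instances of `Scaling/HeatingContractionBetween.lean`. -/
theorem heatingContractionLaw : HeatingContractionLaw :=
  ⟨Theory2.Lattice.U1.heatingContractionBetween, Theory2.Lattice.UN.heatingContractionBetween,
    Theory2.Lattice.SUN.heatingContractionBetween⟩

/-- **The trivializing-map corner for `SU(N)`** (`β = 0` in `HeatingContractionLaw`): every exact trivializing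
map of the `SU(N)` Wilson law (`N ≥ 2`, `d ≥ 2`), invertible or not, has `coLip ≥ e^{cβ - C}`. -/
theorem trivializingMapContraction_of_heating (h : HeatingContractionLaw) (d N : ℕ) (hd : 2 ≤ d) (hN : 2 ≤ N) :
    @Theory2.Lattice.TrivializingMapContraction d N (Matrix.specialUnitaryGroup (Fin N) ℂ) _
      Subtype.metricSpace Theory2.Lattice.SUN.isTopologicalGroup_hs Theory2.Lattice.SUN.compactSpace_hs _
      Theory2.Lattice.SUN.borelSpace_hs (fundamentalRep (Fin N)) :=
  @Theory2.Lattice.trivializingMapContraction_of_heating N (Matrix.specialUnitaryGroup (Fin N) ℂ) _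
    Subtype.metricSpace Theory2.Lattice.SUN.isTopologicalGroup_hs Theory2.Lattice.SUN.compactSpace_hs _
    Theory2.Lattice.SUN.borelSpace_hs (fundamentalRep (Fin N)) d (h.2.2 d N hd hN)

end Summit.Ventures.LatticeQCDFlow.Barriers

end
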